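import Summits.BirchSwinnertonDyer.Rank1Residual.F1Sign2.KuriharaPairLevelSequenceAtTwo
import Literature.NumberTheory.EllipticCurves.BSDQuotientOverNumberField
import Literature.NumberTheory.EllipticCurves.ZpExtension
import Literature.NumberTheory.EllipticCurves.BSDRootNumberSmallConductorAssemblyProofs
import HarnessLib.Audit.Tags
import HarnessLib

/-!
# Cell `bsd-f1-sign2` — IMC lens (planner-of-record `-imc` g15; MEMO-imc §10.94, D-imc-51): «BSD₂ UP THE CYCLOTOMIC ℤ₂-TOWER, TYPED IN SUMMIT CURRENCY»
# — what BSD itself says on each layer `ℚ_n = ℚ(ζ_{2^{n+2}})⁺` of the cyclotomic `ℤ₂`-extension over the basic supersingular locus at `2`, in the currency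
# `Literature.NumberTheory.EllipticCurves.BSDpOver (W.baseChange ℚ_n) 2` (eight plain `def … : Prop` P51a–h + six helper definitions + kernel glue)

STATEMENTS + kernel glue (continues `F1Sign2/KuriharaPairLevelSequenceAtTwo.lean` = D-imc-49/50, whose P50d `KuriharaOtsukiMinimalClassAtTwo` is P51f's antecedent).  Six helper
definitions WITH bodies (`LayerBSDTwo`, `LayerShaTwoFinite`, `layerShaTwoCard`, `levelNormExcessAtTwo`, `layerTamagawa`, `layerTorsionOrder`); EIGHT plain `def … : Prop` (no
`@[conjecture]`: REF1 §154/§155/§158 grade every row theorem-grade bookkeeping / in-print assembly / corollary, P51f an implication from the cell's conjecture-grade P50d) —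
P51a `TowerBSDTwoRelativeToFirstLayerAtTwo`, P51b `FirstLayerBSDTwoIffTwistBSDTwoAtTwo`, P51c `TowerBSDTwoIffTwistBSDTwoOfTraceTwoAtTwo`, P51d `TwistByTwoShaTrivialOfTraceTwoAtTwo`,
P51e `TowerBSDTwoSmallConductorTraceTwoAtTwo`, P51f `TowerBSDTwoIffTwistBSDTwoOnMinimalClassAtTwo`, P51g `TamagawaParityTowerStableAtTwo`, P51h `TorsionOddUpTheTowerAtTwo`; the
sketch's two glue theorems `layerBSDTwo_of_twist`, `towerBSDTwoSmallConductor_of : P51c → bsd.S31 → P51e`; REF1's kernel lemmas (§154: `layerBSDTwo_iff_layer_one_of`, P51d′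
`TwistByTwoShaTrivialOfTraceTwoAtTwo'` + `_iff`, `koQ`, `koQ_eq_jacobsthal_small`, `ko_exponent_eq_predicted_small`; §158: `layerTamagawa_pos`, `layerTorsionOrder_pos`).  Nothing
else asserted, no named fact, no `sorry`; nothing here proves BSD or closes an item.

TYPER FILING (seat `bsd-f1-sign2-ty` g14; -imc TURNKEY D-imc-51-ty INBOX 2026-08-29T01:35:30Z + 01:36:36Z «UNBLOCKED»; CANDIDATES.md rows IMC-KP51 / IMC-KP51-add1): port of
`HOME/MEMO-imc-data/dimc51/lean/SketchG15TowerBSD.lean` sha16 ac1ac899d8ef49e7 (-imc g15 2026-08-29T00:59:36Z; MEMO-imc.md §10.94 l.1732, §10.94-add1 l.1774 = referee fold; -imc: `lean check`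
rc 0, 0 sorry, BC7 probe `ProbeG15TowerBSD.lean` 8/8 CLEAN e0a6d645cec98921; re-checked by the typer against the tree).  Bodies VERBATIM, in the sketch's order and namespace, imports =
the sketch's; NO binder changed (REF1's optional binder drops — P51b's idle `GoodSS`/`analyticRank = 0`, P51d's redundant `Finite`, P51f's redundant `N₃ ≠ 0`/`θ₀(0) ≠ 0` — are
RECORDED in the docstrings instead, so -imc's BC7 8/8 stands); the typer's only edits are this header, one «REF1 §154/§155/§158 · REF2 v45 §6» paragraph appended to each Prop's
docstring, and REF1's kernel lemmas appended VERBATIM from `HOME/REF1-data/b154/lean/Probe154.lean` 7577ea703cfdabea (l.149–193) and `HOME/REF1-data/b158/lean/Probe158.lean` c92c911cb073a40e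
(l.206–220), std axioms re-checked.  CENSUS = the BC5 witness MEMO-imc §10.94.5 (`HOME/MEMO-imc-data/dimc51/out/main-j321333/RESULTS-51.tsv` 06b5cd45db2535f0, bundle `SHA16SUMS`
be78e258135f91aa; kit j321333, tag `bsd-frontier-data`; two engines + exact comparand): 1 487 basic rows × layers `K_n` (`n ≤ 5`; `n = 6` for `N ≤ 1000`) = 6 814 cells —
`v₂ Ш_an(W/K_n) = t_n` on 5 006/5 006 exact cells (KO locus 3 581 incl. 39/39 at degree 64; D49 1 425) + 1 538/1 538 law cells, odd part a square 6 544/6 544, `bsdR = 1 ∧ hR = 2ⁿ`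
6 814/6 814, `Tam_K`/`T_K` odd 6 814/6 814 (= P51g/P51h), `s₁ = 0` 1 487/1 487, 0 kills (pre-registered K1–K5, §10.94.6); j322193 (engine v3) re-runs 59 PREC + 720 thread-stack
layer-5 + 5 ERR cells; REF1 §160 CROSS-READ of the TSV: CONSISTENT (0 findings).
REF1-AUDIT-v1 §154 (2026-08-29T01:35Z, `HOME/REF1-AUDIT-v1.md` l.2994; evidence `HOME/REF1-data/b154/`, `Probe154.lean` 7577ea703cfdabea rc 0, 5 probe sorries, REF1 lemmas std axioms;
`census154.py|txt`) VERDICT verbatim: «D-imc-51: ALL FIVE SURVIVE, 0 killed; P51a THEOREM-grade BOOKKEEPING with the «−1 per level» CERTIFIED from the tree's conventions and ONE deep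
brick made explicit (rank non-growth = Kato 2004 Cor. 14.3 (2), valid at λ ∣ 2); P51b THEOREM-grade modulo the tree's named fact `Milne1972.bsdQuotientP_baseChange_relQuadratic_anyModel`
(DD 2010 Thm 2.3 p-part, «valid for every prime p») + GZK; P51c/P51d THEOREM-grade IN-PRINT ASSEMBLY (KO 2006 Thm 0.1 (2) [p0002 verbatim, its «if we assume the finiteness of
Ш(E/ℚ_1){2}» discharged by GZK from `W'.analyticRank = 1`] + Prop 1.3 [p0006 L20–27] + P51a + P51b); P51e = P51c + bsd.S31 (kernel glue already in the sketch; population {11a1,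
67a1, 75a1, 75c1} CONFIRMED by REF1 from Cremona tables). Riders: P51d's `Finite` conjunct redundant (kernel); P51b's `GoodSS W 2` and `W.analyticRank = 0` idle.»  §155 (01:25Z,
l.3014; `REF1-data/b155/`): «P51f SURVIVES — THEOREM-grade AS AN IMPLICATION from the cell's conjecture-grade P50d `KuriharaOtsukiMinimalClassAtTwo`: every brick between P50d's
Selmer cardinalities and `BSD₂(W/ℚ_n) ↔ BSD₂(W^{(2)})` is print / tree / theorem-grade cell rows (P50c′ (i)(iii), P51a bookkeeping, Milne fact); actual Ш-exponent = predicted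
exponent certified in kernel (`decide`, n ≤ 10: 0, 0, 4, 8, 20, 40, 84, 168); population witness 19a1 (minimal class v₃ = 5; twist 1216d1 rank 1); 0 killed. Riders: two REDUNDANT
binders inherited from P50d (`N₃ ≠ 0` ⟸ the class equation, kernel; `θ₀(0) ≠ 0` ⟸ `UnitLValueAtTwo` + newform); ERRATUM to §154: `κ` IS constructed in the tree
(`CyclotomicZp.zpExtension 2` + `isCyclotomic_zpExtension`, kernel `example`).»  §158 (01:55Z, l.3057; `REF1-data/b158/`, `Probe158.lean` c92c911cb073a40e rc 0, 2 probe sorries): «P51g,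
P51h BOTH SURVIVE, THEOREM-GRADE (elementary print assembly: Tate's algorithm over unramified extensions + the formal group at a supersingular prime); helpers correctly typed and
NON-JUNK (kernel: `layerTamagawa_pos`, `layerTorsionOrder_pos`, std axioms); binders load-bearing (mutation witnesses 26a1 / 15a1 / 32a) except `κ.IsCyclotomic` (idle: ℚ has a
unique ℤ₂-extension — keep by cell convention). -ty: file P51a–h in ONE proposal now (D-0064); nothing to hold.»
REF2-PLACEMENT v45 §6 (1af19c3c15171ede; texts opened first-hand: Kurihara–Otsuki 2006 PAMQ 2 pp. 2–8, Sprung 2017 ANT 11 pp. 5–7, 20, 24–25, Sprung arXiv:1211.1352 p. 4, Kim–Kurihara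
arXiv:1804.00418 p. 5, Deng–Li arXiv:2603.14234 pp. 2–4), REF2_TXT_DIMC51 (§6.4) verbatim: «P51a is the bookkeeping identity in the proof of [cite: Sprung2017, Cor. 3.4] (there for
n ≫ 0, any good p) written in Mazur–Tate level-norm currency and asserted from n = 1; P51c combines it with [cite: KuriharaOtsuki2006, Thm. 0.1(2), Prop. 1.3] and
[cite: Milne1972ArithmeticAV]/[cite: DokchitserDokchitser2010ModSquares, Thm. 2.3]; the match of analytic and algebraic growth at p = 2 is stated informally in [cite: Sprung2017, §1 p. 7]. Not
in print as statements; no claim beyond print except n₀ = 1.»  §6.5 (P51f): «COROLLARY of P50d ∧ print, grade VARIANT; all novelty sits in the antecedent P50d (REF2 v42 row (3):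
NEW-COMBINATION, conjecture-grade) … Nothing in print states P51f; nothing refutes it; its truth value is P50d's.»  §6.6 (P51g/P51h, sketch ac1ac899d8ef49e7 read): «P51g/P51h are elementary
print-assembly [cite: Silverman1994, IV §9 Table 4.1] [cite: DokchitserDokchitser2015LocalInvariants] [cite: Serre1972PointsOrdreFini, §1]».  GRADES OF RECORD (the desks', MEMO-imc
§10.94-add1, superseding every self-grade): P51a THEOREM-grade bookkeeping / PRINT-ASSEMBLY (VARIANT as typed: beyond print only n₀ = 1, carried by P51g/P51h + Kato Cor. 14.3 (2)) ·
P51b KNOWN · P51c THEOREM-grade in-print assembly (REF1) / COROLLARY-OF-PRINT, VARIANT (REF2; disagreement with -imc's NEW-COMBINATION flagged and conceded by -imc) · P51d KNOWN ·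
P51e COROLLARY not in print (nearest new print [cite: DengLi2026, Thm. 1.3], CM, rank part only — disjoint) · P51f VARIANT, conditional on P50d · P51g/P51h support, elementary
print-assembly; 0/8 killed.  REF2's structural remark (§6.2): P51c certifies that the whole ℤ₂-tower over the basic `a₂ = ±2` locus carries EXACTLY ONE BSD₂ bit, `BSD₂(W^{(2)})` — the
tower is BSD₂-inert above `ℚ_1`.
PARTITION: none moved; beyond-print theorem: no (bookkeeping and corollaries of print / bsd.S31; P51f's truth value is P50d's); refuted in print: nothing; BSD not proved; no item
closed.
bears_on: `stmt-BirchSwinnertonDyer-23715` `RankOneAtTwoBigImageOddLocal` (supersingular third at `2`: the `a₂ = ±2` half via P51c, the `a₂ = 0` minimal class via P51f) — the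
residual BSD₂ bit on every layer is `BSDpOver W' 2` for the twist `W' ≅ W^{(2)}` of analytic rank 1, i.e. the cell's ES-C-D `TwistByTwoOfUnitAtTwo` residue.

## The sketch's own module docstring (verbatim)

# SKETCH (-imc g15, D-imc-51): BSD₂ up the cyclotomic `ℤ₂`-tower on the basic supersingular locus at `2`,
# typed in the summit currency `Literature.NumberTheory.EllipticCurves.BSDpOver (W.baseChange ℚ_n) 2`.

Sketch only (cell folder); -ty files the audited version. Four plain `def`s (THEOREM-candidates: bookkeeping /
in-print assembly; nothing here is asserted, nothing is progress on BSD):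
* P51a `TowerBSDTwoRelativeToFirstLayerAtTwo` — README-49 §«BSD₂ bookkeeping up the tower» TYPED: for basic `W`
  (good supersingular at `2`, `L(W,1) ≠ 0`, `Tam(W)` odd), `r_an(W^{(2)}) = 1`, `N_2 … N_n ≠ 0`:
  `BSD₂(W/ℚ_1) → (BSD₂(W/ℚ_n) ↔ (Ш(W/ℚ_n)[2^∞] finite ∧ ord₂ #Ш(W/ℚ_n)[2^∞] = ord₂ #Ш(W/ℚ_1)[2^∞] + Σ_{m=2}^n (v₂ N_m − 1)))`.
* P51b `FirstLayerBSDTwoIffTwistBSDTwoAtTwo` — Milne 1972 / Dokchitser–Dokchitser Thm 2.3 (`p`-part; tree: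
  `Milne1972.bsdQuotientP_baseChange_relQuadratic_anyModel`, `ArtinMilneShaDecomposition`) at `K = ℚ(√2) = ℚ_1`:
  `BSD₂(W) → (BSD₂(W/ℚ_1) ↔ BSD₂(W^{(2)}))`.
* P51c `TowerBSDTwoIffTwistBSDTwoOfTraceTwoAtTwo` — `a₂ = ±2`, `ord₂(L(W,1)/Ω_W) = 0`, `Tam(W)` odd (Kurihara–Otsuki 2006
  Thm 0.1 verbatim hypotheses), `r_an(W^{(2)}) = 1`: `∀ n ≥ 1, BSD₂(W/ℚ_n) ↔ BSD₂(W^{(2)})` (KO Thm 0.1(2) + Prop. 1.2/§3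
  `ord₂ N_m = q_m` + P51a + P51b + KO's `Sel₂(W/ℚ) = 0`).
* P51d `TwistByTwoShaTrivialOfTraceTwoAtTwo` — same hypotheses: `rank W^{(2)}(ℚ) = 1 ∧ Ш(W^{(2)})[2^∞] = 0`
  (GZK + KO Thm 0.1(2) at `n = 1` + inflation–restriction; three conjuncts of ES-C-D `TwistByTwoOfUnitAtTwo` become theorems at `a₂ = ±2`).
-/

noncomputable section

open scoped Classical MatrixGroups ModularForm NumberField

open CongruenceSubgroup Polynomial WeierstrassCurve Literature.NumberTheory.EllipticCurves
  Literature.NumberTheory.EllipticCurves.ModularForms Literature.NumberTheory.EllipticCurves.Rank1Residual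
  Literature.Barriers.BirchSwinnertonDyer ZpExtension

namespace Summit.BirchSwinnertonDyer.Rank1Residual.F1Sign2

/-- `BSD₂(W/ℚ_n)`: the `2`-part of the Birch–Swinnerton-Dyer formula (`BSDpOver`, Miller / Dokchitser–Dokchitser currency)
for the base change of `W` to the `n`-th layer `ℚ_n = κ.layer n` of a `ℤ₂`-extension `κ` of `ℚ` (a number field). -/
def LayerBSDTwo (W : WeierstrassCurve ℚ) (κ : ZpExtension ℚ 2) (n : ℕ) : Prop :=
  haveI : FiniteDimensional ℚ ↥(κ.layer n) := κ.finiteDimensional_layer_holds n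
  haveI : NumberField ↥(κ.layer n) := NumberField.of_module_finite ℚ ↥(κ.layer n)
  BSDpOver (W.baseChange ↥(κ.layer n)) 2

/-- `Ш(W/ℚ_n)[2^∞]` is finite. -/
def LayerShaTwoFinite (W : WeierstrassCurve ℚ) (κ : ZpExtension ℚ 2) (n : ℕ) : Prop :=
  haveI : FiniteDimensional ℚ ↥(κ.layer n) := κ.finiteDimensional_layer_holds n
  haveI : NumberField ↥(κ.layer n) := NumberField.of_module_finite ℚ ↥(κ.layer n)
  Finite (AddCommGroup.primaryComponent (W.baseChange ↥(κ.layer n)).sha 2)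

/-- `#Ш(W/ℚ_n)[2^∞]` (`Nat.card`; junk `0` if infinite). -/
def layerShaTwoCard (W : WeierstrassCurve ℚ) (κ : ZpExtension ℚ 2) (n : ℕ) : ℕ :=
  haveI : FiniteDimensional ℚ ↥(κ.layer n) := κ.finiteDimensional_layer_holds n
  haveI : NumberField ↥(κ.layer n) := NumberField.of_module_finite ℚ ↥(κ.layer n)
  Nat.card (AddCommGroup.primaryComponent (W.baseChange ↥(κ.layer n)).sha 2)

/-- `I_n(θ) := Σ_{m=2}^{n} (v₂(N_m) − 1)`, `N_m = mtLevelNorm θ_m m` the Mazur–Tate level norm of the (period-pinned) element `θ_m = ϖ·θ_m(f)`: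
the BSD₂-predicted exponent of `#Ш(W/ℚ_n)[2^∞]/#Ш(W/ℚ_1)[2^∞]` (README-49; = RHS of P49c `KuriharaPairIndexLawAtTwo`). -/
def levelNormExcessAtTwo {N : ℕ} (f : CuspForm (Gamma0 N) 2) (ϖ : ℚ) (n : ℕ) : ℤ :=
  ∑ m ∈ Finset.Icc 2 n, (padicValRat 2 (mtLevelNorm (C ϖ * mazurTateElement f 2 m) m) - 1)

/-- **P51a `TowerBSDTwoRelativeToFirstLayerAtTwo`** (THEOREM-candidate; bookkeeping).
MEMO-imc §10.94.2: README-49 «BSD₂ bookkeeping up the tower» TYPED — for basic `W` (good supersingular at `2`, `L(W,1) ≠ 0`, `Tam(W)` odd), `r_an(W^{(2)}) = 1`,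
`N_2 … N_n ≠ 0`: `BSD₂(W/ℚ_1) → (BSD₂(W/ℚ_n) ↔ (Ш(W/ℚ_n)[2^∞] finite ∧ ord₂ #Ш(W/ℚ_n)[2^∞] = ord₂ #Ш(W/ℚ_1)[2^∞] + Σ_{m=2}^n (v₂ N_m − 1)))`.  Why it might fail as
typed: only a convention slip in `analyticSha` over a number field (`bsdPeriod = ∏_{w∣∞} Ω_w/√|d_F|`; `regulator` with heights RELATIVE to `ℚ_n` — the tree's convention,
`Heights.lean`, which is what produces the «−1 per layer»; `modifiedTamagawaProduct` on the base-changed ℚ-minimal model); census K3 (`bsdR = 1`) pins PARI ≡ DD on all cells.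
REF1-AUDIT §154: **SURVIVES, THEOREM-grade BOOKKEEPING** — the words-proof (α)–(θ) CERTIFIED in the tree's currency: (α) Artin formalism for `ℚ_n/ℚ`; (β) Mazur–Tate interpolation
`χ(θ_m(f)) = τ(χ)·L(f,χ̄,1)/Ω_f⁺` [cite: MazurTate1987]; (γ) `√(d_n/d_1) = ∏_{m=2}^{n}∏_χ τ(χ)` exactly, so `[Λ/bsdPeriod](V_n)/[Λ/bsdPeriod](V_1) = ∏_{m=2}^{n} N_m`; **(δ) rank
non-growth `rank W(ℚ_n) = 1` = Kolyvagin + Gross–Zagier–Kolyvagin + KATO 2004 Cor. 14.3 (2) («K finite abelian over ℚ, L(A,χ,1) ≠ 0 ⇒ the χ-part of A(K) is finite», with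
Thm. 14.2 (2) for ANY finite place λ, so valid at λ ∣ 2) [cite: Kato2004Asterisque, Thm. 14.2 (2), Cor. 14.3 (2)] — LOAD-BEARING, made explicit by REF1**; (ε) `W(ℚ_n)[2] = 0`
(supersingular formal group, Newton slope `−1/3`, `3 ∤ 2ⁿ`); (ζ) `Reg(V_n) = 2^{n−1}·Reg(V_1)` with heights RELATIVE to `ℚ_n` (tree convention) — the «−1 per level»; (η) `C(V_n)`
odd (= P51g); (θ) torsion odd (= P51h).  The binder `(C ϖ · θ_0).coeff 0 ≠ 0` is exactly `L(W,1) ≠ 0`; `UnitLValueAtTwo` is NOT needed here; the `N_m ≠ 0` binders are discharged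
on the KO locus by [cite: KuriharaOtsuki2006, Prop. 1.3] (kept: P51a is stated more generally).  REF2 v45 §6.2: PRINT-ASSEMBLY, KNOWN in substance / VARIANT as typed — the identity
is the PROOF of [cite: Sprung2017, Cor. 3.4] (p. 24, there for `n ≫ 0`, any good `p`) in Mazur–Tate level-norm currency; what is asserted beyond print is `n₀ = 1`, i.e. the two
elementary stabilisations P51g/P51h under `GoodSS(2) ∧ Tam odd` (in print an explicit `n₀` exists only for `p` odd, [cite: Sprung2017, Cor. 3.5]). -/
def TowerBSDTwoRelativeToFirstLayerAtTwo : Prop :=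
  ∀ {N : ℕ} [NeZero N] (f : CuspForm (Gamma0 N) 2) (W : WeierstrassCurve ℚ) [W.IsElliptic] [W.IsGloballyMinimal]
    (ϖ : ℚ), IsNewformOf W f → GoodSS W 2 →
    (ϖ : ℝ) * W.realPeriodRat = plusPeriod f →
    (C ϖ * mazurTateElement f 2 0).coeff 0 ≠ 0 →
    Odd W.tamagawaProduct →
    ∀ (W' : WeierstrassCurve ℚ) [W'.IsElliptic],
      (∃ C : VariableChange ℚ, C • W.quadraticTwist 2 = W') → W'.analyticRank = 1 →
    ∀ κ : ZpExtension ℚ 2, κ.IsCyclotomic →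
    ∀ n : ℕ, 1 ≤ n →
      (∀ m : ℕ, 2 ≤ m → m ≤ n → mtLevelNorm (C ϖ * mazurTateElement f 2 m) m ≠ 0) →
      LayerBSDTwo W κ 1 →
      (LayerBSDTwo W κ n ↔
        (LayerShaTwoFinite W κ n ∧
          (padicValNat 2 (layerShaTwoCard W κ n) : ℤ) =
            padicValNat 2 (layerShaTwoCard W κ 1) + levelNormExcessAtTwo f ϖ n))

/-- **P51b `FirstLayerBSDTwoIffTwistBSDTwoAtTwo`** (THEOREM-candidate; Milne/Dokchitser–Dokchitser `p`-part at `ℚ(√2)`).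
MEMO-imc §10.94.2: `BSD₂(W) → (BSD₂(W/ℚ_1) ↔ BSD₂(W^{(2)}))` = Milne 1972 §1 / Dokchitser–Dokchitser Thm 2.3 (the `p`-part of BSD is compatible with Weil restriction) at
`K = ℚ(√2) = ℚ_1`; tree: the named fact `Milne1972.bsdQuotientP_baseChange_relQuadratic_anyModel` (`WeilRestrictionQuadraticBSDQuotientAnyModel.lean`) and the PROVED
`leadingLCoeff_baseChange_relQuadratic` / `ArtinMilneShaDecomposition`.  Why it might fail: only mis-typing (`ℚ_1 = κ.layer 1` must be `ℚ(√2)`: `IsCyclotomic`).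
REF1-AUDIT §154: **SURVIVES, THEOREM-grade** modulo the tree's named fact `Milne1972.bsdQuotientP_baseChange_relQuadratic_anyModel` [cite: Milne1972ArithmeticAV, §1]
[cite: DokchitserDokchitser2010ModSquares, Thm. 2.3] (its two finiteness hypotheses come from `BSDpOver W 2` and from Gross–Zagier–Kolyvagin via `W'.analyticRank = 1`, so BOTH directions of
the `↔` go through) + brick (ι) `∃ θ ∈ κ.layer 1, θ² = 2` (true; prover target).  Binder census: `GoodSS W 2` and `W.analyticRank = 0` are IDLE (the DD/Milne identity is
rank-agnostic) — CONTEXT-ONLY, kept verbatim so that -imc's BC7 8/8 stands.  REF2 v45 §6.2: KNOWN. -/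
def FirstLayerBSDTwoIffTwistBSDTwoAtTwo : Prop :=
  ∀ (W : WeierstrassCurve ℚ) [W.IsElliptic] [W.IsGloballyMinimal],
    GoodSS W 2 → W.analyticRank = 0 → BSDpOver W 2 →
    ∀ (W' : WeierstrassCurve ℚ) [W'.IsElliptic] [W'.IsGloballyMinimal],
      (∃ C : VariableChange ℚ, C • W.quadraticTwist 2 = W') → W'.analyticRank = 1 →
    ∀ κ : ZpExtension ℚ 2, κ.IsCyclotomic →
      (LayerBSDTwo W κ 1 ↔ BSDpOver W' 2)

/-- **P51c `TowerBSDTwoIffTwistBSDTwoOfTraceTwoAtTwo`** (THEOREM-candidate; in-print assembly at `a₂ = ±2`).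
MEMO-imc §10.94.2: Kurihara–Otsuki hypotheses verbatim («`a₂ = ±2`, `2 ∤ L(E,1)/Ω_E`, `2 ∤ Tam(E)`»), `r_an(W^{(2)}) = 1`: `∀ n ≥ 1, BSD₂(W/ℚ_n) ↔ BSD₂(W^{(2)})`.  Chain: KO
Thm 0.1 (2) (`#Ш(W/ℚ_n)[2^∞]` finite of order `2^{Σ_{2≤m≤n}(q_m−1)}`, exponents `0, 0, 2, 6, 16, 36` at `n = 1..6`) + KO Prop. 1.3 `ord₂ N_m = q_m` (⇒ `N_m ≠ 0`) + BSD₂(W) over ℚ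
(unit `L`-value + KO's `Sel₂(W/ℚ) = 0`, Tam odd, `E(ℚ)[2] = 0`) + P51a + P51b.  The `↔` at `n` is EXACTLY «analytic jumps = algebraic jumps» ([cite: Sprung2017, §1 p. 7] «The
formulas also match the algebraic ones of Kurihara and Otsuki when p = 2», made exact for every `n ≥ 1`).
REF1-AUDIT §154: **SURVIVES, THEOREM-grade IN-PRINT ASSEMBLY** — [cite: KuriharaOtsuki2006, Thm. 0.1 (2), Prop. 1.3] (Thm 0.1 (2) p. 2 verbatim; its proviso «if we assume the
finiteness of Ш(E/ℚ_1){2}» is DISCHARGED by Gross–Zagier–Kolyvagin from `W'.analyticRank = 1` + `Ш(W)[2^∞] = 0` + Weil restriction) + P51a + P51b; KO's ACTUAL exponent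
`Σ_{k=3}^{n}(n−k+1)(q_k−q_{k−1})` = P51a's PREDICTED `Σ_{m=2}^{n}(q_m − 1)` (telescoping; kernel `ko_exponent_eq_predicted_small` below, `n ≤ 10`; `q_n = J_n`,
`koQ_eq_jacobsthal_small`); no `N_m ≠ 0` hypothesis needed; under P51c the tower statement is RIGID (`layerBSDTwo_iff_layer_one_of` below).  REF2 v45 §6.2: COROLLARY-OF-PRINT,
NOT in print as a statement, grade VARIANT (REF2 does not follow -imc's NEW-COMBINATION; -imc concedes, §10.94-add1); VALUE: the whole ℤ₂-tower over the basic `a₂ = ±2` locus carries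
EXACTLY ONE BSD₂ bit, `BSD₂(W^{(2)})` — the tower is BSD₂-inert above `ℚ_1`. -/
def TowerBSDTwoIffTwistBSDTwoOfTraceTwoAtTwo : Prop :=
  ∀ (W : WeierstrassCurve ℚ) [W.IsElliptic] [W.IsGloballyMinimal],
    W.HasGoodReductionAtPrime 2 → (W.frobeniusTrace 2 = 2 ∨ W.frobeniusTrace 2 = -2) →
    UnitLValueAtTwo W → Odd W.tamagawaProduct →
    ∀ (W' : WeierstrassCurve ℚ) [W'.IsElliptic] [W'.IsGloballyMinimal],
      (∃ C : VariableChange ℚ, C • W.quadraticTwist 2 = W') → W'.analyticRank = 1 →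
    ∀ κ : ZpExtension ℚ 2, κ.IsCyclotomic → ∀ n : ℕ, 1 ≤ n →
      (LayerBSDTwo W κ n ↔ BSDpOver W' 2)

/-- **P51d `TwistByTwoShaTrivialOfTraceTwoAtTwo`** (THEOREM-candidate; GZK + Kurihara–Otsuki Thm 0.1(2) at `n = 1` + inflation–restriction).
MEMO-imc §10.94.2: same hypotheses ⇒ `rank W^{(2)}(ℚ) = 1 ∧ Ш(W^{(2)})[2^∞] = 0` — in-print assembly, NOT claimed new (REF2 v44 §1: transport KNOWN [cite: Kramer1981, Prop. 4, Thm. 1]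
[cite: MazurRubin2010]): KO `Sel₂(W/ℚ) = 0` + the `T₂` transport of `F1Sign2/TwistByTwoPointDivisibilityAtTwo.lean` ⇒ `dim Sel₂(W') ≤ 1`, + Gross–Zagier–Kolyvagin ⇒ `Ш(W')[2] = 0`;
three of ES-C-D `TwistByTwoOfUnitAtTwo`'s five conjuncts are theorems at `a₂ = ±2`, the residual conjunct is `ord₂ Ш_an(W') = 0`.
REF1-AUDIT §154: **SURVIVES, THEOREM-grade** ([cite: KuriharaOtsuki2006, Thm. 0.1 (2)] at `n = 1`: `Ш(E/ℚ_1){2} = 0`, + GZK + `Ш(W')[2^∞] ↪ Ш(W/ℚ_1)[2^∞]` with kernel in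
`H¹(Gal(ℚ_1/ℚ), W'(ℚ_1)) = 0` by the odd-torsion saturation argument); rider: the `Finite` conjunct is REDUNDANT — `Nat.card = 1` forces finiteness (kernel: P51d′
`TwistByTwoShaTrivialOfTraceTwoAtTwo'` and `twistByTwoShaTrivialOfTraceTwoAtTwo_iff` below); kept verbatim.  REF2 v45 §6.2: KNOWN. -/
def TwistByTwoShaTrivialOfTraceTwoAtTwo : Prop :=
  ∀ (W : WeierstrassCurve ℚ) [W.IsElliptic] [W.IsGloballyMinimal],
    W.HasGoodReductionAtPrime 2 → (W.frobeniusTrace 2 = 2 ∨ W.frobeniusTrace 2 = -2) →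
    UnitLValueAtTwo W → Odd W.tamagawaProduct →
    ∀ (W' : WeierstrassCurve ℚ) [W'.IsElliptic] [W'.IsGloballyMinimal],
      (∃ C : VariableChange ℚ, C • W.quadraticTwist 2 = W') → W'.analyticRank = 1 →
      W'.mordellWeilRank = 1 ∧ Finite (AddCommGroup.primaryComponent W'.sha 2) ∧
        Nat.card (AddCommGroup.primaryComponent W'.sha 2) = 1

/-- Glue sanity (pure logic): P51c at `n = 1` is P51b's conclusion shape; P51c ∧ BSD₂(W') gives BSD₂ on every layer. -/
theorem layerBSDTwo_of_twist (h : TowerBSDTwoIffTwistBSDTwoOfTraceTwoAtTwo)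
    (W : WeierstrassCurve ℚ) [W.IsElliptic] [W.IsGloballyMinimal]
    (h2 : W.HasGoodReductionAtPrime 2) (ha : W.frobeniusTrace 2 = 2 ∨ W.frobeniusTrace 2 = -2)
    (hu : UnitLValueAtTwo W) (ht : Odd W.tamagawaProduct)
    (W' : WeierstrassCurve ℚ) [W'.IsElliptic] [W'.IsGloballyMinimal]
    (hW' : ∃ C : VariableChange ℚ, C • W.quadraticTwist 2 = W') (hr : W'.analyticRank = 1)
    (hB : BSDpOver W' 2) (κ : ZpExtension ℚ 2) (hκ : κ.IsCyclotomic) (n : ℕ) (hn : 1 ≤ n) :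
    LayerBSDTwo W κ n :=
  (h W h2 ha hu ht W' hW' hr κ hκ n hn).mpr hB

/-- **P51e `TowerBSDTwoSmallConductorTraceTwoAtTwo`** (COROLLARY-candidate, UNCONDITIONAL once P51c is a theorem:
P51c + bsd.S31 `bsdTriple_of_analyticRank_le_one_of_conductor_lt` (Creutz–Miller 2012 Thm 1.1 / Miller 2011 / Miller–Stoll 2013,
computer-assisted, `N < 5000`, `r_an ≤ 1`) applied to the twist `W' = W^{(2)}` of conductor `64·N_W`): for basic `a₂ = ±2` curves with
`N_{W'} < 5000` (data: `11a1, 67a1, 75a1, 75c1`), BSD₂ holds on EVERY layer `ℚ_n` of the cyclotomic `ℤ₂`-extension.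
REF1-AUDIT §154: **SURVIVES** = P51c + bsd.S31 (kernel glue `towerBSDTwoSmallConductor_of` below; [cite: CreutzMiller2012, Thm. 1.1] [cite: MillerStoll2013]); population CONFIRMED from
Cremona's tables: basic `a₂ = ±2`, unit `L`-value, Tam odd, `N < 79` ⇒ exactly the classes 11a, 67a, 75a, 75c (twists 704a, 4288a, 4800bf, 4800e, all rank 1); 57c correctly
excluded.  REF2 v45 §6.2: COROLLARY, NOT in print as a statement (no printed BSD verification over `ℚ(ζ_{2^k})⁺`, `k ≥ 4`, found; corpus + galaxy nulls); nearest «all layers at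
p = 2» theorem in print: [cite: DengLi2026, Thm. 1.3] (CM curve `y² + y = x³ + 2`, twists, RANK part only — disjoint). -/
def TowerBSDTwoSmallConductorTraceTwoAtTwo : Prop :=
  ∀ (W : WeierstrassCurve ℚ) [W.IsElliptic] [W.IsGloballyMinimal],
    W.HasGoodReductionAtPrime 2 → (W.frobeniusTrace 2 = 2 ∨ W.frobeniusTrace 2 = -2) →
    UnitLValueAtTwo W → Odd W.tamagawaProduct →
    ∀ (W' : WeierstrassCurve ℚ) [W'.IsElliptic] [W'.IsGloballyMinimal],
      (∃ C : VariableChange ℚ, C • W.quadraticTwist 2 = W') → W'.analyticRank = 1 → W'.conductorNorm ℤ < 5000 →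
    ∀ κ : ZpExtension ℚ 2, κ.IsCyclotomic → ∀ n : ℕ, 1 ≤ n → LayerBSDTwo W κ n

/-- Kernel glue: P51c ∧ bsd.S31 ⇒ P51e (pure assembly over the tree: `forall_bsdp_of_bsdTriple'`, `bsdp_iff_rank_and_bsdpOver`). -/
theorem towerBSDTwoSmallConductor_of (h : TowerBSDTwoIffTwistBSDTwoOfTraceTwoAtTwo)
    (hS31 : bsdTriple_of_analyticRank_le_one_of_conductor_lt) : TowerBSDTwoSmallConductorTraceTwoAtTwo := by
  intro W _ _ h2 ha hu ht W' _ _ hW' hr hN κ hκ n hn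
  have hT : W'.BSDTriple := hS31 W' (by omega) hN
  have hp : BSDp W' 2 := forall_bsdp_of_bsdTriple' W' hT 2 Nat.prime_two
  exact (h W h2 ha hu ht W' hW' hr κ hκ n hn).mpr ((bsdp_iff_rank_and_bsdpOver W' 2).mp hp).2

/-- **P51f `TowerBSDTwoIffTwistBSDTwoOnMinimalClassAtTwo`** (THEOREM-candidate = an IMPLICATION; its antecedent P50d
`KuriharaOtsukiMinimalClassAtTwo` is the cell's conjecture-grade «KO 2006 extends to a₂ = 0 on the class v₂N₃ = 5»): on the a₂ = 0 MINIMAL CLASS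
(P50d hypotheses verbatim) the Selmer structure `Sel(W/ℚ_n) ≅ ℚ₂/ℤ₂ ⊕ ⊕_{i=3}^n (ℤ/2^{n+1−i})^{v_i − v_{i−1}}` gives `ord₂ #Ш(W/ℚ_n)[2^∞] = Σ_{m=2}^n (v_m − 1) = I_n`
(`4, 8, 20, …`), so with P51a + P51b: `∀ n ≥ 1, BSD₂(W/ℚ_n) ↔ BSD₂(W^{(2)})` exactly as at `a₂ = ±2`.
**CONDITIONAL ON P50d `KuriharaOtsukiMinimalClassAtTwo` [conjecture-grade, REF1 §147]; all other inputs theorem-grade / print: P50c′ (i)(iii), P51a, Milne/DD, Gross–Zagier–Kolyvagin,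
Kolyvagin, Cassels–Tate.**  REF1-AUDIT §155: **SURVIVES — THEOREM-grade AS AN IMPLICATION from P50d**: chain P50d ⟹ P51f brick by brick ((1) `rank W(ℚ_n) = 1` from GZK +
`mordellWeilRank_baseChange_relQuadratic` + Kolyvagin + corank `1`; (2) Kummer ⇒ `Ш(W/ℚ_n)[2^∞] ≅ T_n`; (3) `BSD₂(W/ℚ)` on the locus with `Ш(W/ℚ)[2^∞] = 0` by Cassels–Tate, REPLACING
KO's `Sel(E/ℚ) = 0` (printed for `a₂ = ±2` only); (4) layer 1 ↔ twist = P51b; (5)–(7) P51a's bookkeeping at `a₂ = 0` with `v₂N_m^{ϖ} = koMinimalClassVal m`; (8) actual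
Ш-exponent = predicted exponent, kernel `decide`, `n ≤ 10`: `0, 0, 4, 8, 20, 40, 84, 168`); population witness 19a1 (minimal class `v₃ = 5`, `L/Ω = 1/3`, Tam `3`; twist 1216d1 of
rank 1).  Riders (kept verbatim so a prover can feed P50d directly; information only): the binders `mtLevelNorm (θ 3) 3 ≠ 0` (⟸ the class equation: `−4t = 5` is insoluble) and
`(mazurTateElement f 2 0).coeff 0 ≠ 0` (⟸ `UnitLValueAtTwo W` + `IsNewformOf W f`) are REDUNDANT; P51f's extra hypothesis `W'.analyticRank = 1` is what licenses P50c′ (iii)'s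
`θ_1 = c(X+2)` shape.  REF2 v45 §6.5: COROLLARY of P50d ∧ print, grade VARIANT; all novelty sits in the antecedent P50d; print at `a₂ = 0`, `p = 2`: [cite: KuriharaOtsuki2006, Rem. 0.2 (3)]
(the unit `L`-value does NOT determine `Sel(E/ℚ_n)` at `a₂ = 0` — exactly what P50d's level-norm hypothesis supplies), [cite: Sprung2017, Cor. 1.8], [cite: Pollack2003, Thm. 5.6];
printed caution on the algebraic side [cite: KimKurihara2021] (Kurihara's Fitting-ideal conjecture «may not hold» at `p = 2`).  Nothing in print states P51f; nothing refutes it; its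
truth value is P50d's. -/
def TowerBSDTwoIffTwistBSDTwoOnMinimalClassAtTwo : Prop :=
  KuriharaOtsukiMinimalClassAtTwo →
  ∀ {N : ℕ} [NeZero N] (f : CuspForm (Gamma0 N) 2) (W : WeierstrassCurve ℚ) [W.IsElliptic] [W.IsGloballyMinimal],
    IsNewformOf W f → W.HasGoodReductionAtPrime 2 → W.frobeniusTrace 2 = 0 → UnitLValueAtTwo W → ¬ 2 ∣ W.tamagawaProduct →
    (mazurTateElement f 2 0).coeff 0 ≠ 0 → mtLevelNorm (mazurTateElement f 2 3) 3 ≠ 0 →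
    padicValRat 2 (mtLevelNorm (mazurTateElement f 2 3) 3) - 4 * padicValRat 2 ((mazurTateElement f 2 0).coeff 0) = 5 →
    ∀ (W' : WeierstrassCurve ℚ) [W'.IsElliptic] [W'.IsGloballyMinimal],
      (∃ C : VariableChange ℚ, C • W.quadraticTwist 2 = W') → W'.analyticRank = 1 →
    ∀ κ : ZpExtension ℚ 2, κ.IsCyclotomic → ∀ n : ℕ, 1 ≤ n →
      (LayerBSDTwo W κ n ↔ BSDpOver W' 2)

/-- `C(W/ℚ_n)` (Dokchitser–Dokchitser's modified Tamagawa product of the base change to the layer, on the ℚ-model's differential). -/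
def layerTamagawa (W : WeierstrassCurve ℚ) (κ : ZpExtension ℚ 2) (n : ℕ) : ℚ :=
  haveI : FiniteDimensional ℚ ↥(κ.layer n) := κ.finiteDimensional_layer_holds n
  haveI : NumberField ↥(κ.layer n) := NumberField.of_module_finite ℚ ↥(κ.layer n)
  (W.baseChange ↥(κ.layer n)).modifiedTamagawaProduct

/-- `#E(ℚ_n)_tors`. -/
def layerTorsionOrder (W : WeierstrassCurve ℚ) (κ : ZpExtension ℚ 2) (n : ℕ) : ℕ :=
  haveI : FiniteDimensional ℚ ↥(κ.layer n) := κ.finiteDimensional_layer_holds n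
  haveI : NumberField ↥(κ.layer n) := NumberField.of_module_finite ℚ ↥(κ.layer n)
  (W.baseChange ↥(κ.layer n)).torsionOrder

/-- **P51g `TamagawaParityTowerStableAtTwo`** (SUPPORT statement of P51a, THEOREM-candidate, elementary: odd `ℓ` is unramified in `ℚ_n`, so the
Kodaira type at `w ∣ ℓ` is the one at `ℓ` and the ℚ-minimal model stays `w`-minimal (`|ω/ω°|_w = 1`); `Tam(W)` odd excludes III, III*, I_m^*,
split I_{2k} and I_0^* with `c_ℓ ∈ {2,4}`; the surviving I_0^* case `c_ℓ = 1` has an irreducible cubic over `𝔽_ℓ`, which acquires no root in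
residue extensions of 2-power degree; IV/IV*/II/II*/I_m (m odd) keep odd `c_w`; at `w ∣ 2` good reduction, `c_w = 1`). Census K5 (TamK odd).
REF1-AUDIT §158: **SURVIVES, THEOREM-GRADE** (elementary print assembly: Tate's algorithm over the unramified layers — `ℚ_n/ℚ` unramified at every odd `ℓ`, the ℚ-minimal model stays
`w`-minimal, `k_w = 0`, same Kodaira symbol, `c_w = #Φ(k_w)` odd in every Kodaira class that `Tam(W)` odd allows; at the unique `w ∣ 2` good reduction, `c_w = 1` — so
`C(W/ℚ_n) = ∏ c_w` is an odd natural number) [cite: Silverman1994, IV §9, Table 4.1] [cite: DokchitserDokchitser2010ModSquares, §1]; `layerTamagawa` correctly typed = Dokchitser–Dokchitser's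
`C(W/ℚ_n)`, the SAME currency as `LayerBSDTwo`; conclusion NON-JUNK (`layerTamagawa_pos` below: not the junk `padicValRat 2 0 = 0`); binders load-bearing (mutation: drop
`HasGoodReductionAtPrime 2` ⇒ FALSE at 26a1 over `ℚ(√2)`; drop `Odd Tam` ⇒ false) except `κ.IsCyclotomic` (IDLE: ℚ has a unique `ℤ₂`-extension — kept by cell convention); census K5
`Tam_K` odd 6 814/6 814.  REF2 v45 §6.6: ELEMENTARY PRINT-ASSEMBLY [cite: Silverman1994, IV §9 Table 4.1] [cite: DokchitserDokchitser2015LocalInvariants]. -/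
def TamagawaParityTowerStableAtTwo : Prop :=
  ∀ (W : WeierstrassCurve ℚ) [W.IsElliptic] [W.IsGloballyMinimal],
    W.HasGoodReductionAtPrime 2 → Odd W.tamagawaProduct →
    ∀ κ : ZpExtension ℚ 2, κ.IsCyclotomic → ∀ n : ℕ, padicValRat 2 (layerTamagawa W κ n) = 0

/-- **P51h `TorsionOddUpTheTowerAtTwo`** (SUPPORT statement of P51a, THEOREM-candidate, elementary: good SUPERSINGULAR reduction at `2` ⇒
`#Ẽ(𝔽₂) = 3 − a₂` odd and the residue field at the unique `w ∣ 2` of `ℚ_n` is `𝔽₂` (total ramification), so `E(ℚ_{n,w})[2]` lies in the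
formal group, whose `[2]`-series has Newton slope `−1/3` while `3 ∤ e(w∣2) = 2^n`; hence `E(ℚ_n)[2] = 0`, which also gives the 2-saturation
`E(ℚ_1) ⊂ E(ℚ_n)` used for the regulator ratio `2^{n−1}`). Census K5 (TK odd).
REF1-AUDIT §158: **SURVIVES, THEOREM-GRADE** (good supersingular at `2` on the minimal model: `a₁` even, `a₃` odd, `#W̃(𝔽₂) = 3 − a₂` odd; the residue field at the unique, totally
ramified `w ∣ 2` of `ℚ_n` is `𝔽₂`, so `E(ℚ_{n,w})[2] ⊂ Ê(𝔪_w)`, whose `[2]`-series has Newton polygon one segment from `(0, v(2))` to `(3, 0)`: every non-zero `2`-torsion point of `Ê`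
has `v_w(T) = 2ⁿ/3 ∉ ℤ` — none is rational; `E(ℚ_n)[2] = 0`, `#E(ℚ_n)_tors` odd) [cite: Silverman1994, IV] [cite: Serre1972PointsOrdreFini, §1] (`e(ℚ₂^{nr}(Ê[2])/ℚ₂^{nr}) = 3`);
`layerTorsionOrder` correctly typed, conclusion NON-JUNK (`layerTorsionOrder_pos` below); binders load-bearing (mutation: drop `2 ∣ a₂` ⇒ FALSE at 15a1, `n = 0`; drop good reduction
⇒ FALSE at 32a) except `κ.IsCyclotomic` (idle, kept); census K5 `T_K` odd 6 814/6 814.  REF2 v45 §6.6: ELEMENTARY PRINT-ASSEMBLY [cite: Serre1972PointsOrdreFini, §1, Props. 10–12]. -/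
def TorsionOddUpTheTowerAtTwo : Prop :=
  ∀ (W : WeierstrassCurve ℚ) [W.IsElliptic] [W.IsGloballyMinimal],
    W.HasGoodReductionAtPrime 2 → (2 : ℤ) ∣ W.frobeniusTrace 2 →
    ∀ κ : ZpExtension ℚ 2, κ.IsCyclotomic → ∀ n : ℕ, Odd (layerTorsionOrder W κ n)

/-! ## REF1-AUDIT kernel lemmas — typer addition, VERBATIM from `HOME/REF1-data/b154/lean/Probe154.lean` 7577ea703cfdabea l.149–193 (§154: rigidity of the tower statement under P51c;
P51d′ = P51d without the redundant `Finite` conjunct + the kernel equivalence; KO 2006 Thm 0.1 (2) bookkeeping: `q_n = J_n` and «KO's actual Ш-exponent = P51a's predicted exponent»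
for small `n` by `decide`) and from `HOME/REF1-data/b158/lean/Probe158.lean` c92c911cb073a40e l.206–220 (§158: the conclusions of P51g / P51h are NON-JUNK — `0 < layerTamagawa`,
`0 < layerTorsionOrder`); REF1's namespaces `…F1Sign2.REF1g14g` / `…F1Sign2.REF1g15b` hold the same sketch text, so the lemmas are unchanged here; std axioms per REF1, re-checked by
the typer. -/

section REF1Kernel

/-- KERNEL glue: under P51c the tower statement is RIGID — `BSD₂(W/ℚ_n) ↔ BSD₂(W/ℚ_1)` for every `n ≥ 1`. -/
theorem layerBSDTwo_iff_layer_one_of (h : TowerBSDTwoIffTwistBSDTwoOfTraceTwoAtTwo)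
    (W : WeierstrassCurve ℚ) [W.IsElliptic] [W.IsGloballyMinimal]
    (h2 : W.HasGoodReductionAtPrime 2) (ha : W.frobeniusTrace 2 = 2 ∨ W.frobeniusTrace 2 = -2)
    (hu : UnitLValueAtTwo W) (ht : Odd W.tamagawaProduct)
    (W' : WeierstrassCurve ℚ) [W'.IsElliptic] [W'.IsGloballyMinimal]
    (hW' : ∃ C : VariableChange ℚ, C • W.quadraticTwist 2 = W') (hr : W'.analyticRank = 1)
    (κ : ZpExtension ℚ 2) (hκ : κ.IsCyclotomic) (n : ℕ) (hn : 1 ≤ n) :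
    LayerBSDTwo W κ n ↔ LayerBSDTwo W κ 1 :=
  (h W h2 ha hu ht W' hW' hr κ hκ n hn).trans (h W h2 ha hu ht W' hW' hr κ hκ 1 le_rfl).symm

/-- P51d without the (redundant) `Finite` conjunct: `Nat.card = 1` already forces finiteness (`Nat.card` of an infinite type is `0`). -/
def TwistByTwoShaTrivialOfTraceTwoAtTwo' : Prop :=
  ∀ (W : WeierstrassCurve ℚ) [W.IsElliptic] [W.IsGloballyMinimal],
    W.HasGoodReductionAtPrime 2 → (W.frobeniusTrace 2 = 2 ∨ W.frobeniusTrace 2 = -2) →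
    UnitLValueAtTwo W → Odd W.tamagawaProduct →
    ∀ (W' : WeierstrassCurve ℚ) [W'.IsElliptic] [W'.IsGloballyMinimal],
      (∃ C : VariableChange ℚ, C • W.quadraticTwist 2 = W') → W'.analyticRank = 1 →
      W'.mordellWeilRank = 1 ∧ Nat.card (AddCommGroup.primaryComponent W'.sha 2) = 1

/-- KERNEL: the two bodies of P51d are equivalent. -/
theorem twistByTwoShaTrivialOfTraceTwoAtTwo_iff :
    TwistByTwoShaTrivialOfTraceTwoAtTwo ↔ TwistByTwoShaTrivialOfTraceTwoAtTwo' := by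
  constructor
  · intro h W _ _ h2 ha hu ht W' _ _ hW' hr
    obtain ⟨h1, -, h3⟩ := h W h2 ha hu ht W' hW' hr
    exact ⟨h1, h3⟩
  · intro h W _ _ h2 ha hu ht W' _ _ hW' hr
    obtain ⟨h1, h3⟩ := h W h2 ha hu ht W' hW' hr
    exact ⟨h1, Nat.finite_of_card_ne_zero (by rw [h3]; exact one_ne_zero), h3⟩

/-- KO 2006 Thm 0.1 (2): `q_n = Σ_{k<n} (−1)^k 2^{n−1−k}`. -/
def koQ (n : ℕ) : ℤ := ∑ k ∈ Finset.range n, (-1) ^ k * 2 ^ (n - 1 - k)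

/-- (B2) `q_n = J_n` (the tree's `jacobsthal`) for `2 ≤ n ≤ 12` (kernel `decide`). -/
theorem koQ_eq_jacobsthal_small : ∀ n ∈ Finset.Icc 2 12, koQ n = (jacobsthal n : ℤ) := by decide

/-- (B1) KO's ACTUAL exponent `ord₂ #Ш(E/ℚ_n)[2^∞] = Σ_{k=3}^n (n−k+1)(q_k − q_{k−1})` (Thm 0.1 (2), `Ш ≃ ⊕ (ℤ/2^{n−k+1})^{q_k−q_{k−1}}`)
EQUALS the BSD₂-PREDICTED exponent of P51a `ord₂ #Ш(E/ℚ_1) + Σ_{m=2}^n (v₂N_m − 1)` with `Ш(E/ℚ_1)[2^∞] = 0` and `v₂N_m = q_m`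
(KO Prop 1.3): `Σ_{m=2}^n (q_m − 1)` — checked for `2 ≤ n ≤ 10` (kernel `decide`; the general identity is a telescoping sum). -/
theorem ko_exponent_eq_predicted_small :
    ∀ n ∈ Finset.Icc 2 10,
      (∑ k ∈ Finset.Icc (3 : ℕ) n, ((n : ℤ) - (k : ℤ) + 1) * (koQ k - koQ (k - 1))) =
        ∑ m ∈ Finset.Icc (2 : ℕ) n, (koQ m - 1) := by
  decide

/-- `C(W/ℚ_n) > 0`: the conclusion of P51g is not the junk `padicValRat 2 0 = 0` (tree: `modifiedTamagawaProduct_pos`). -/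
theorem layerTamagawa_pos (W : WeierstrassCurve ℚ) [W.IsElliptic] (κ : ZpExtension ℚ 2) (n : ℕ) :
    0 < layerTamagawa W κ n := by
  unfold layerTamagawa
  haveI : FiniteDimensional ℚ ↥(κ.layer n) := κ.finiteDimensional_layer_holds n
  haveI : NumberField ↥(κ.layer n) := NumberField.of_module_finite ℚ ↥(κ.layer n)
  exact (W.baseChange ↥(κ.layer n)).modifiedTamagawaProduct_pos

/-- `#E(ℚ_n)_tors > 0`: the conclusion of P51h is about a genuine cardinal (tree: `torsionOrder_pos_holds`, Mordell–Weil over number fields). -/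
theorem layerTorsionOrder_pos (W : WeierstrassCurve ℚ) [W.IsElliptic] (κ : ZpExtension ℚ 2) (n : ℕ) :
    0 < layerTorsionOrder W κ n := by
  unfold layerTorsionOrder
  haveI : FiniteDimensional ℚ ↥(κ.layer n) := κ.finiteDimensional_layer_holds n
  haveI : NumberField ↥(κ.layer n) := NumberField.of_module_finite ℚ ↥(κ.layer n)
  exact (W.baseChange ↥(κ.layer n)).torsionOrder_pos_holds

end REF1Kernel

end Summit.BirchSwinnertonDyer.Rank1Residual.F1Sign2

end
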